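import HarnessLib

/-!
# BirchSwinnertonDyer — rank ≥ 2 observatory: the `|Ш|` census joined to Kurihara numbers (anom seat, gen 4) — DATA

HONEST FRAMING: per-curve certified theorems and census instruments; no claim on BSD in rank ≥ 2.

CENSUS DATA ONLY (REFEREE P6/R7: DATA-labelled `def`s, never theorems about elliptic curves). Every `def`
transcribes a number printed in `run/shared/lean/b2b/bsd-rank2-observatory/b2b-bsdr2-anom/CONSISTENCY-JOINS.md`
§"Gen 4 joins" and its machine-readable sources
`b2b-bsdr2-anom/joins-outputs/{JOIN-KURIHARA,JOIN-KURIHARA-LOCAL,JOIN-B2-g4}.summary.json` and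
`b2b-bsdr2-anom/joins-outputs/j5impl2-j095484/J5-IMPL2-AGREEMENT.json` (each records the sha256 of every input
and of its uncompressed output). The census (358 159 curves of rank 2 and 3, `N < 5·10⁵`; consistent 358 159,
anomalies under verification 0; `S = 1` on 358 117 rows, `S = 4` on 42) is the leaf `Rank2ObservatoryAnomCensus`
(p213044) and the gen-3 joins are `Rank2ObservatoryAnomJoins` (p214942); nothing here changes a census verdict.

* J4 — the census × the Kurihara-number lane (`run/shared/lean/speedrun/kurihara/`, PARI `msfromell`; `δ_n mod p`,
  `p ∈ {5,7,11,13}`, `N ≤ 59 998`). By C.-H. Kim, Amer. J. Math. 148 (2026) Thm 1.8 (= arXiv:2203.12159 Thm 1.9):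
  `p ≥ 5`, `ρ̄_{E,p}` surjective, Manin constant prime to `p`, one unit `δ_n` with `ν(n) = r` plus `r` independent
  points and `E(ℚ)[p] = 0` ⇒ `Sel(ℚ,E[p^∞]) ≅ (ℚ_p/ℤ_p)^r`, `Ш(E/ℚ)[p^∞] = 0`. Only `δ_n mod p` is taken from the
  lane (its implementation 1, audited there by an independent implementation on fixed 1 % samples); EVERY
  hypothesis is recomputed on the census side: Kolyvagin congruences with own `a_ℓ`, `ν(n) = r`, surjectivity by
  own Frobenius witnesses for Serre's criterion (Invent. Math. 15 (1972) Prop. 19) AND by the Cremona–Sutherland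
  `galrep` table, `p ∤ #E(ℚ)_tors`; consistency = `v_p(S) = 0` (one-directional: a non-vanishing `δ_n` proves
  `p ∤ #Ш`, which the census predicts; a vanishing one proves nothing). Class-mates through isogenies of degree
  prime to `p` (read from `allisog`).
* J5 — local conditions at the Kolyvagin primes of every J4 certificate: cyclicity of `E(F_ℓ)[p^∞]` (Kurihara,
  Contrib. Math. Comput. Sci. 7 (2014) §1.2, `𝒫₁`; Kim Thm 2.1 = Mazur–Rubin condition) and Kim Thm 1.11 /
  Kurihara Conj. 1.2.4 (with `Sel(ℚ,E[p]) = E(ℚ)/p`): the reduction map `E(ℚ)/p → ⊕_{ℓ∣n} E(F_ℓ)/p` of the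
  index-certified Mordell–Weil basis is an isomorphism (an explicit `r × r` matrix of discrete logs nonsingular
  mod `p`), tested on the non-anomalous certificates (`a_p ≢ 1`, `p ∤ ∏c_ℓ`, `p ∤ #T`); zero levels of the lane
  tabulated as information. TWO IMPLEMENTATIONS (exact integer arithmetic in Python; PARI `ellcard` /
  `ellgroup` / `ellgenerators`, kit job j095484) compared level by level.
* J1-g4 — the gen-3 two-engine join of check (b2) re-run unchanged after cert-3 published tiers T5 and T6
  (T6 to a checkpoint: 62 798 of 74 326 rows computed).

Scripts: `code/b2b-bsdr2-anom/joins/{join_kurihara.py, join_kurihara_local.py, j5impl2/, join_b2.py}` (README,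
SHA256SUMS); jobs in `b2b-bsdr2-anom/JOBS.md`.
-/

namespace Summit.BirchSwinnertonDyer.BirchSwinnertonDyer.Rank2Observatory.AnomJoins2

/-- DATA (not a theorem): J4 per prime `p`: lane certificates `(E, p, n)` joined (`rows`), of which rank 2 /
rank 3, rows with every recomputed hypothesis true and `v_p(S) = 0` (`consistent`), rows at which `p` is
anomalous (`a_p ≡ 1 mod p`, recorded for J5), and mismatches. -/
structure KuriharaByPrime where
  p : Nat
  rows : Nat
  rankTwo : Nat
  rankThree : Nat
  consistent : Nat
  mismatch : Nat
  deriving Repr, DecidableEq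

/-- DATA (not a theorem): `JOIN-KURIHARA.summary.json: counts` per prime. -/
def kuriharaByPrime : List KuriharaByPrime := [
  { p := 5,  rows := 11564, rankTwo := 11500, rankThree := 64, consistent := 11564, mismatch := 0 },
  { p := 7,  rows := 13909, rankTwo := 13891, rankThree := 18, consistent := 13909, mismatch := 0 },
  { p := 11, rows := 14398, rankTwo := 14391, rankThree := 7,  consistent := 14398, mismatch := 0 },
  { p := 13, rows := 13135, rankTwo := 13135, rankThree := 0,  consistent := 13135, mismatch := 0 } ]

/-- DATA (not a theorem): J4 totals. `laneRows` = lane certificates with `E` a census curve; `surjSerreWitness` =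
rows with own Frobenius witnesses `(q₁,q₂,q₃)`, `q ≤ qMax`, for Serre's Prop. 19; `surjGalrepAgrees` = rows where
the `galrep` table does not list `p`; `aEllAgree` = rows whose own `a_ℓ` at every `ℓ ∣ n` equal the lane's;
`goodOrdinary` / `goodSupersingular` / `anomalous` = reduction type of `p`; `classMateRows` / `classMateConsistent`
= `(E′, p)` rows reached through a prime-to-`p` isogeny; `impl2SampleAgreeRows` = joined rows whose exact
`(E,p,n)` lies in the lane's implementation-2 audit sample (all agree); coverage at `N ≤ maxConductor`: census
rank-2 / rank-3 curves and classes in range, classes with ≥ 1 certificate, curves (incl. class-mates) with ≥ 1,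
curves with certificates at all four primes; `sFourRowsInRange` = census `S = 4` curves in the lane's range;
`certsLines` / `certsSha256` = the lane file as streamed (line count, sha256 prefix); `outputRows` /
`outputSha256` = `JOIN-KURIHARA.tsv` (lane + class-mate rows; sha256 prefix, uncompressed). -/
structure KuriharaJoin where
  laneRows : Nat
  laneRowsRankTwo : Nat
  laneRowsRankThree : Nat
  consistent : Nat
  mismatch : Nat
  qMax : Nat
  surjSerreWitness : Nat
  surjGalrepAgrees : Nat
  aEllAgree : Nat
  goodOrdinary : Nat
  goodSupersingular : Nat
  anomalous : Nat
  classMateRows : Nat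
  classMateConsistent : Nat
  impl2SampleAgreeRows : Nat
  maxConductor : Nat
  censusRankTwoCurvesInRange : Nat
  censusRankTwoClassesInRange : Nat
  censusRankThreeCurvesInRange : Nat
  censusRankThreeClassesInRange : Nat
  rankTwoClassesWithCertificate : Nat
  rankThreeClassesWithCertificate : Nat
  rankTwoCurvesWithCertificate : Nat
  rankThreeCurvesWithCertificate : Nat
  curvesWithAllFourPrimes : Nat
  sFourRowsInRange : Nat
  certsLines : Nat
  certsSha256 : String
  outputRows : Nat
  outputSha256 : String
  deriving Repr, DecidableEq

/-- DATA (not a theorem): `JOIN-KURIHARA.summary.json` totals (run 2026-08-20T10:35Z). -/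
def kuriharaJoin : KuriharaJoin :=
  { laneRows := 53006, laneRowsRankTwo := 52917, laneRowsRankThree := 89, consistent := 53006, mismatch := 0,
    qMax := 400, surjSerreWitness := 53006, surjGalrepAgrees := 53006, aEllAgree := 53006,
    goodOrdinary := 46007, goodSupersingular := 6999, anomalous := 4220,
    classMateRows := 10257, classMateConsistent := 10257, impl2SampleAgreeRows := 5, maxConductor := 59998,
    censusRankTwoCurvesInRange := 30068, censusRankTwoClassesInRange := 24012,
    censusRankThreeCurvesInRange := 178, censusRankThreeClassesInRange := 176,
    rankTwoClassesWithCertificate := 19104, rankThreeClassesWithCertificate := 82,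
    rankTwoCurvesWithCertificate := 23141, rankThreeCurvesWithCertificate := 83, curvesWithAllFourPrimes := 4622,
    sFourRowsInRange := 0, certsLines := 371658, certsSha256 := "a91f64a6c8f71db2",
    outputRows := 63263, outputSha256 := "c1f9895a7470f630" }

example : (kuriharaByPrime.map (·.rows)).sum = kuriharaJoin.laneRows := by decide
example : (kuriharaByPrime.map (·.rankTwo)).sum = kuriharaJoin.laneRowsRankTwo
    ∧ (kuriharaByPrime.map (·.rankThree)).sum = kuriharaJoin.laneRowsRankThree := by decide
example : (kuriharaByPrime.map (·.consistent)).sum = kuriharaJoin.consistent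
    ∧ (kuriharaByPrime.map (·.mismatch)).sum = 0 := by decide
example : kuriharaJoin.consistent = kuriharaJoin.laneRows ∧ kuriharaJoin.surjSerreWitness = kuriharaJoin.laneRows
    ∧ kuriharaJoin.surjGalrepAgrees = kuriharaJoin.laneRows ∧ kuriharaJoin.aEllAgree = kuriharaJoin.laneRows := by decide
example : kuriharaJoin.goodOrdinary + kuriharaJoin.goodSupersingular = kuriharaJoin.laneRows := by decide
example : kuriharaJoin.laneRows + kuriharaJoin.classMateRows = kuriharaJoin.outputRows
    ∧ kuriharaJoin.classMateConsistent = kuriharaJoin.classMateRows := by decide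

/-- DATA (not a theorem): J5 per prime `p`: Kolyvagin-prime slots `ℓ ∣ n` of the certificates with CYCLIC
`E(F_ℓ)[p^∞]` (`cyclicSlots`; there is no non-cyclic slot on a certificate), certificates with the hypotheses of
Kim Thm 1.11 true and the reduction map an isomorphism (`isoVerified`), anomalous certificates on which the
isomorphism is observed with no theorem invoked (`anomalousIsoObserved`), and the lane's ZERO data: pairs `(E,p)`
of rank ≥ 2 with `δ_n ≡ 0` at every tried level, tried levels with a non-cyclic prime, with all primes cyclic and
the matrix singular, with all cyclic and the matrix nonsingular. -/
structure KuriharaLocalByPrime where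
  p : Nat
  cyclicSlots : Nat
  isoVerified : Nat
  anomalousIsoObserved : Nat
  zeroPairs : Nat
  zeroLevelsNonCyclic : Nat
  zeroLevelsSingular : Nat
  zeroLevelsNeither : Nat
  deriving Repr, DecidableEq

/-- DATA (not a theorem): `JOIN-KURIHARA-LOCAL.summary.json: counts` per prime. -/
def kuriharaLocalByPrime : List KuriharaLocalByPrime := [
  { p := 5,  cyclicSlots := 23192, isoVerified := 9537,  anomalousIsoObserved := 2027, zeroPairs := 530,
    zeroLevelsNonCyclic := 831, zeroLevelsSingular := 857, zeroLevelsNeither := 0 },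
  { p := 7,  cyclicSlots := 27836, isoVerified := 13005, anomalousIsoObserved := 904,  zeroPairs := 384,
    zeroLevelsNonCyclic := 666, zeroLevelsSingular := 525, zeroLevelsNeither := 0 },
  { p := 11, cyclicSlots := 28803, isoVerified := 13877, anomalousIsoObserved := 521,  zeroPairs := 182,
    zeroLevelsNonCyclic := 104, zeroLevelsSingular := 263, zeroLevelsNeither := 0 },
  { p := 13, cyclicSlots := 26270, isoVerified := 12367, anomalousIsoObserved := 768,  zeroPairs := 229,
    zeroLevelsNonCyclic := 173, zeroLevelsSingular := 230, zeroLevelsNeither := 0 } ]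

/-- DATA (not a theorem): J5 totals. `levels` = certificates + zero levels examined; `cyclicSlots` /
`nonCyclicSlotsOnCertificates`; `isoVerified` (rank 2 / 3), `anomalousIsoObserved`, `hypothesisFailuresOther`
(`p ∣ Tam`, `p ∣ #T`, index, surjectivity — none), `allHypothesesTrueMatrixSingular` (would be an anomaly under
verification); distinct `(E, ℓ, p)` structures computed (cyclic / non-cyclic, the latter only in zero levels);
`zeroPairsAllObstructed` = zero pairs every tried level of which is locally obstructed; `anomalyUnderVerification`;
two implementations: levels compared, agreeing on `#E(F_ℓ)`, on the structures, all-cyclic levels agreeing on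
singular/nonsingular (= nonsingular certificates + singular zero levels) and on the rank; `impl2Job`; sha256
prefixes of the uncompressed outputs and of the implementation-2 input. -/
structure KuriharaLocalJoin where
  certificates : Nat
  zeroLevels : Nat
  levels : Nat
  cyclicSlots : Nat
  nonCyclicSlotsOnCertificates : Nat
  isoVerified : Nat
  isoVerifiedRankTwo : Nat
  isoVerifiedRankThree : Nat
  anomalousIsoObserved : Nat
  hypothesisFailuresOther : Nat
  allHypothesesTrueMatrixSingular : Nat
  distinctStructuresCyclic : Nat
  distinctStructuresNonCyclic : Nat
  zeroPairs : Nat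
  zeroPairsAllObstructed : Nat
  anomalyUnderVerification : Nat
  implCompared : Nat
  implCardAgree : Nat
  implStructureAgree : Nat
  implSingularityAgree : Nat
  implSingularityAgreeNonsingular : Nat
  implSingularityAgreeSingular : Nat
  implRankAgree : Nat
  implDisagree : Nat
  impl2Job : String
  impl2InputSha256 : String
  outputSha256 : String
  impl2OutputSha256 : String
  deriving Repr, DecidableEq

/-- DATA (not a theorem): `JOIN-KURIHARA-LOCAL.summary.json` + `J5-IMPL2-AGREEMENT.json` totals. -/
def kuriharaLocalJoin : KuriharaLocalJoin :=
  { certificates := 53006, zeroLevels := 3649, levels := 56655, cyclicSlots := 106101, nonCyclicSlotsOnCertificates := 0,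
    isoVerified := 48786, isoVerifiedRankTwo := 48719, isoVerifiedRankThree := 67, anomalousIsoObserved := 4220,
    hypothesisFailuresOther := 0, allHypothesesTrueMatrixSingular := 0,
    distinctStructuresCyclic := 110144, distinctStructuresNonCyclic := 691,
    zeroPairs := 1325, zeroPairsAllObstructed := 1325, anomalyUnderVerification := 0,
    implCompared := 56655, implCardAgree := 56655, implStructureAgree := 56655, implSingularityAgree := 54881,
    implSingularityAgreeNonsingular := 53006, implSingularityAgreeSingular := 1875, implRankAgree := 54881, implDisagree := 0,
    impl2Job := "j095484", impl2InputSha256 := "edc93b5c04f3f657",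
    outputSha256 := "1cbd16beb3f5ac22", impl2OutputSha256 := "65e156d36108c244" }

example : kuriharaLocalJoin.certificates = kuriharaJoin.laneRows
    ∧ kuriharaLocalJoin.certificates + kuriharaLocalJoin.zeroLevels = kuriharaLocalJoin.levels := by decide
example : (kuriharaLocalByPrime.map (·.cyclicSlots)).sum = kuriharaLocalJoin.cyclicSlots := by decide
example : (kuriharaLocalByPrime.map (·.isoVerified)).sum = kuriharaLocalJoin.isoVerified
    ∧ (kuriharaLocalByPrime.map (·.anomalousIsoObserved)).sum = kuriharaLocalJoin.anomalousIsoObserved := by decide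
example : kuriharaLocalJoin.isoVerified + kuriharaLocalJoin.anomalousIsoObserved = kuriharaLocalJoin.certificates
    ∧ kuriharaLocalJoin.anomalousIsoObserved = kuriharaJoin.anomalous
    ∧ kuriharaLocalJoin.isoVerifiedRankTwo + kuriharaLocalJoin.isoVerifiedRankThree = kuriharaLocalJoin.isoVerified := by decide
example : (kuriharaLocalByPrime.map (·.zeroPairs)).sum = kuriharaLocalJoin.zeroPairs
    ∧ (kuriharaLocalByPrime.map (fun r => r.zeroLevelsNonCyclic + r.zeroLevelsSingular + r.zeroLevelsNeither)).sum
      = kuriharaLocalJoin.zeroLevels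
    ∧ (kuriharaLocalByPrime.map (·.zeroLevelsNeither)).sum = 0 := by decide
example : kuriharaLocalJoin.implCompared = kuriharaLocalJoin.levels ∧ kuriharaLocalJoin.implCardAgree = kuriharaLocalJoin.levels
    ∧ kuriharaLocalJoin.implStructureAgree = kuriharaLocalJoin.levels ∧ kuriharaLocalJoin.implDisagree = 0
    ∧ kuriharaLocalJoin.implSingularityAgreeNonsingular = kuriharaLocalJoin.certificates
    ∧ kuriharaLocalJoin.implSingularityAgreeNonsingular + kuriharaLocalJoin.implSingularityAgreeSingular
      = kuriharaLocalJoin.implSingularityAgree := by decide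

/-- DATA (not a theorem): J1-g4 per conductor band `[lo·10⁵, hi·10⁵)`, rank 2: rows, rows two-engine on (b2), rows
one-engine (engine A only) — `JOIN-B2-g4.summary.json: coverage.rank2_by_band` (re-run of 2026-08-20T10:56Z with
cert-3's T5 and T6-checkpoint). -/
structure B2Band where
  lo : Nat
  hi : Nat
  rows : Nat
  twoEngine : Nat
  oneEngine : Nat
  deriving Repr, DecidableEq

/-- DATA (not a theorem): see `B2Band`. -/
def b2BandsG4 : List B2Band := [
  { lo := 0, hi := 1, rows := 56975, twoEngine := 56975, oneEngine := 0 },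
  { lo := 1, hi := 2, rows := 69868, twoEngine := 69868, oneEngine := 0 },
  { lo := 2, hi := 3, rows := 72987, twoEngine := 72987, oneEngine := 0 },
  { lo := 3, hi := 4, rows := 74516, twoEngine := 74516, oneEngine := 0 },
  { lo := 4, hi := 5, rows := 74326, twoEngine := 62824, oneEngine := 11502 } ]

/-- DATA (not a theorem): J1-g4 totals: engine-B AGREEMENT rows read per source (T5, T6 new; T6 = 62 798 computed
+ 11 528 `MISSING(B)`), census rows by engine status and rank, anomalies / incomplete, the largest `N` below which
every rank-2 row is two-engine, sha256 prefix of the uncompressed `JOIN-B2-g4.tsv`. -/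
structure B2JoinG4 where
  rows : Nat
  engineBRowsT5 : Nat
  engineBRowsT6 : Nat
  engineBRowsT6Computed : Nat
  engineBRowsT6Missing : Nat
  twoEngineRankTwo : Nat
  twoEngineRankThree : Nat
  oneEngineRankTwo : Nat
  anomaly : Nat
  incomplete : Nat
  allRankTwoTwoEngineBelowN : Nat
  outputSha256 : String
  deriving Repr, DecidableEq

/-- DATA (not a theorem): `JOIN-B2-g4.summary.json` totals. -/
def b2JoinG4 : B2JoinG4 :=
  { rows := 358159, engineBRowsT5 := 74516, engineBRowsT6 := 74326, engineBRowsT6Computed := 62798, engineBRowsT6Missing := 11528,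
    twoEngineRankTwo := 337170, twoEngineRankThree := 9487, oneEngineRankTwo := 11502, anomaly := 0, incomplete := 0,
    allRankTwoTwoEngineBelowN := 400000, outputSha256 := "60d6712e493ef344" }

example : (b2BandsG4.map (·.rows)).sum = b2JoinG4.twoEngineRankTwo + b2JoinG4.oneEngineRankTwo
    ∧ (b2BandsG4.map (·.twoEngine)).sum = b2JoinG4.twoEngineRankTwo := by decide
example : b2JoinG4.twoEngineRankTwo + b2JoinG4.oneEngineRankTwo + b2JoinG4.twoEngineRankThree = b2JoinG4.rows := by decide
example : b2JoinG4.engineBRowsT6Computed + b2JoinG4.engineBRowsT6Missing = b2JoinG4.engineBRowsT6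
    ∧ b2JoinG4.oneEngineRankTwo ≤ b2JoinG4.engineBRowsT6Missing := by decide

end Summit.BirchSwinnertonDyer.BirchSwinnertonDyer.Rank2Observatory.AnomJoins2
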